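import Mathlib

/-! # Free scalars for integral border `Q`-words: stub `stub_ibqSmul` of line `Sketch`
(eps-order-ladder) for crux `WordLengthQP` (stmt-ValiantsHypothesis-6623)

An integral border `Q`-word for `f : MvPolynomial σ ℂ` (shift `≤ μ`, precision `κ`, length
`≤ L`; the predicate is spelled out as an existential over lists of letters, see the statement)
yields one for `γ • f`, for every `γ : ℂ`, with the same shift and precision and length
`≤ L + 6`.  For `γ = 0` the one-letter word `Q(0)` works.  For `γ ≠ 0` pick `α` with
`α * α = -γ` (`ℂ` is algebraically closed); the constant letters `Q(a) = [[a, 1], [1, 0]]`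
satisfy `Q(α) Q(-α⁻¹) Q(α) = diag(α, -α⁻¹)`, `Q(-α) Q(α⁻¹) Q(-α) = diag(-α, α⁻¹)` and
`diag(α, -α⁻¹) · Q(f) · diag(-α, α⁻¹) = Q(-α² f) = Q(γ f)`, so conjugating the given word by
these two three-letter words multiplies `f` by `γ` exactly, keeps the shift `ε^M` and only
conjugates the error matrix.

Source: K. Bringmann, C. Ikenmeyer, J. Zuiddam, *On algebraic branching programs of small width*,
J. ACM 65 (2018) art. 32 (= CCC 2017, arXiv:1702.05328), §3 (width-2 border simulation;
scalars are free via diagonal conjugation). -/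

-- `Summit.ValiantsHypothesis.ValiantsHypothesis.…` is the tree's mandated single-conjunct layout (Sub = Summit).
set_option linter.dupNamespace false

noncomputable section

open MvPolynomial

namespace Summit.ValiantsHypothesis.ValiantsHypothesis.Cruxes.WordLengthQP.EpsOrderLadder

/-- `Q(a) Q(-b) Q(a) = diag(a, -b)` whenever `a * b = 1` (over any commutative ring). -/
private theorem ibqSmul_triple_left {R : Type*} [CommRing R] {a b : R} (h : a * b = 1) :
    (!![a, 1; 1, 0] : Matrix (Fin 2) (Fin 2) R) * !![-b, 1; 1, 0] * !![a, 1; 1, 0]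
      = !![a, 0; 0, -b] := by
  have e : (!![a, 1; 1, 0] : Matrix (Fin 2) (Fin 2) R) * !![-b, 1; 1, 0] * !![a, 1; 1, 0]
      = !![a + a * (1 - a * b), 1 - a * b; 1 - a * b, -b] := by
    rw [Matrix.mul_fin_two, Matrix.mul_fin_two]
    ext i j
    fin_cases i <;> fin_cases j <;> simp <;> ring
  rw [e, h, sub_self, mul_zero, add_zero]

/-- `Q(-a) Q(b) Q(-a) = diag(-a, b)` whenever `a * b = 1`. -/
private theorem ibqSmul_triple_right {R : Type*} [CommRing R] {a b : R} (h : a * b = 1) :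
    (!![-a, 1; 1, 0] : Matrix (Fin 2) (Fin 2) R) * !![b, 1; 1, 0] * !![-a, 1; 1, 0]
      = !![-a, 0; 0, b] := by
  have e : (!![-a, 1; 1, 0] : Matrix (Fin 2) (Fin 2) R) * !![b, 1; 1, 0] * !![-a, 1; 1, 0]
      = !![-a - a * (1 - a * b), 1 - a * b; 1 - a * b, b] := by
    rw [Matrix.mul_fin_two, Matrix.mul_fin_two]
    ext i j
    fin_cases i <;> fin_cases j <;> simp <;> ring
  rw [e, h, sub_self, mul_zero, sub_zero]

/-- `diag(a, -b) · Q(F) · diag(-a, b) = [[-(a·a) F, a b], [a b, 0]]`. -/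
private theorem ibqSmul_diag_conj {R : Type*} [CommRing R] (a b F : R) :
    (!![a, 0; 0, -b] : Matrix (Fin 2) (Fin 2) R) * !![F, 1; 1, 0] * !![-a, 0; 0, b]
      = !![-(a * a) * F, a * b; a * b, 0] := by
  rw [Matrix.mul_fin_two, Matrix.mul_fin_two]
  ext i j
  fin_cases i <;> fin_cases j <;> simp <;> ring

/-- The product of the matrices of three constant letters `((a, none), 0)`, `((b, none), 0)`,
`((c, none), 0)` is `Q(a) Q(b) Q(c)`. -/
private theorem ibqSmul_word3 {σ : Type} (a b c : Polynomial ℂ) :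
    (([((a, none), 0), ((b, none), 0), ((c, none), 0)] :
        List ((Polynomial ℂ × Option σ) × ℕ)).map
        (fun l => (!![MvPolynomial.C l.1.1 * l.1.2.elim 1 MvPolynomial.X,
            MvPolynomial.C (Polynomial.X ^ l.2); MvPolynomial.C (Polynomial.X ^ l.2), 0] :
              Matrix (Fin 2) (Fin 2) (MvPolynomial σ (Polynomial ℂ))))).prod
      = !![MvPolynomial.C a, 1; 1, 0] * !![MvPolynomial.C b, 1; 1, 0]
          * !![MvPolynomial.C c, 1; 1, 0] := by
  simp only [List.map_cons, List.map_nil, List.prod_cons, List.prod_nil, Option.elim_none,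
    pow_zero, map_one, mul_one, Matrix.mul_assoc]

/-- **stub_ibqSmul** (scalars are free, exact): for `α ≠ 0`, `Q(α)Q(-α⁻¹)Q(α) = diag(α,-α⁻¹)` and
`Q(-α)Q(α⁻¹)Q(-α) = diag(-α,α⁻¹)`, and `diag(α,-α⁻¹) · Q(f) · diag(-α,α⁻¹) = Q(-α² f)`; over `ℂ`
choose `α² = -γ` (`IsAlgClosed.exists_eq_mul_self`); `γ = 0` is the one-letter word `Q(0)`. -/
theorem stub_ibqSmul :
    ∀ {σ : Type} (γ : ℂ) (f : MvPolynomial σ ℂ) (μ κ L : ℕ),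
      (∃ w : List ((Polynomial ℂ × Option σ) × ℕ), w.length ≤ L ∧ ∃ M : ℕ, M ≤ μ ∧
        ∃ G : Matrix (Fin 2) (Fin 2) (MvPolynomial σ (Polynomial ℂ)),
          (w.map (fun l => (!![MvPolynomial.C l.1.1 * l.1.2.elim 1 MvPolynomial.X,
              MvPolynomial.C (Polynomial.X ^ l.2); MvPolynomial.C (Polynomial.X ^ l.2), 0] :
                Matrix (Fin 2) (Fin 2) (MvPolynomial σ (Polynomial ℂ))))).prod
            = (MvPolynomial.C (Polynomial.X ^ M) : MvPolynomial σ (Polynomial ℂ)) •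
                (!![MvPolynomial.map Polynomial.C f, 1; 1, 0] :
                  Matrix (Fin 2) (Fin 2) (MvPolynomial σ (Polynomial ℂ)))
              + (MvPolynomial.C (Polynomial.X ^ (M + κ)) : MvPolynomial σ (Polynomial ℂ)) • G) →
      (∃ w : List ((Polynomial ℂ × Option σ) × ℕ), w.length ≤ L + 6 ∧ ∃ M : ℕ, M ≤ μ ∧
        ∃ G : Matrix (Fin 2) (Fin 2) (MvPolynomial σ (Polynomial ℂ)),
          (w.map (fun l => (!![MvPolynomial.C l.1.1 * l.1.2.elim 1 MvPolynomial.X,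
              MvPolynomial.C (Polynomial.X ^ l.2); MvPolynomial.C (Polynomial.X ^ l.2), 0] :
                Matrix (Fin 2) (Fin 2) (MvPolynomial σ (Polynomial ℂ))))).prod
            = (MvPolynomial.C (Polynomial.X ^ M) : MvPolynomial σ (Polynomial ℂ)) •
                (!![MvPolynomial.map Polynomial.C (γ • f), 1; 1, 0] :
                  Matrix (Fin 2) (Fin 2) (MvPolynomial σ (Polynomial ℂ)))
              + (MvPolynomial.C (Polynomial.X ^ (M + κ)) : MvPolynomial σ (Polynomial ℂ)) • G) := by
  intro σ γ f μ κ L hf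
  obtain ⟨w, hwL, M, hM, G, hprod⟩ := hf
  rcases eq_or_ne γ 0 with rfl | hγ
  · -- `γ = 0`: the one-letter word `Q(0)`.
    refine ⟨[((0, none), 0)], ?_, 0, Nat.zero_le μ, 0, ?_⟩
    · simp only [List.length_cons, List.length_nil]
      omega
    · simp
  · -- `γ ≠ 0`: conjugate by `diag(α, -α⁻¹)` and `diag(-α, α⁻¹)` where `α * α = -γ`.
    obtain ⟨α, hα2⟩ := IsAlgClosed.exists_eq_mul_self (-γ)
    have hα : α ≠ 0 := by
      rintro rfl
      exact hγ (neg_eq_zero.mp (hα2.trans (mul_zero 0)))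
    -- the scalars, transported into `R = MvPolynomial σ (Polynomial ℂ)`
    have hab : (MvPolynomial.C (Polynomial.C α) : MvPolynomial σ (Polynomial ℂ))
        * MvPolynomial.C (Polynomial.C α⁻¹) = 1 := by
      rw [← map_mul, ← map_mul, mul_inv_cancel₀ hα, map_one, map_one]
    have hsq : -((MvPolynomial.C (Polynomial.C α) : MvPolynomial σ (Polynomial ℂ))
        * MvPolynomial.C (Polynomial.C α)) = MvPolynomial.C (Polynomial.C γ) := by
      rw [← map_mul, ← map_mul, ← hα2, map_neg, map_neg, neg_neg]
    have hmap : MvPolynomial.map Polynomial.C (γ • f)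
        = MvPolynomial.C (Polynomial.C γ) * MvPolynomial.map Polynomial.C f := by
      rw [MvPolynomial.smul_eq_C_mul, map_mul, MvPolynomial.map_C]
    refine ⟨[((Polynomial.C α, none), 0), ((Polynomial.C (-α⁻¹), none), 0),
        ((Polynomial.C α, none), 0)] ++ w ++
        [((Polynomial.C (-α), none), 0), ((Polynomial.C α⁻¹, none), 0),
        ((Polynomial.C (-α), none), 0)], ?_, M, hM,
      !![MvPolynomial.C (Polynomial.C α), 0; 0, -MvPolynomial.C (Polynomial.C α⁻¹)] * G
        * !![-MvPolynomial.C (Polynomial.C α), 0; 0, MvPolynomial.C (Polynomial.C α⁻¹)], ?_⟩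
    · simp only [List.length_append, List.length_cons, List.length_nil]
      omega
    · rw [List.map_append, List.map_append, List.prod_append, List.prod_append, hprod,
        ibqSmul_word3, ibqSmul_word3, map_neg, map_neg, map_neg, map_neg,
        ibqSmul_triple_left hab, ibqSmul_triple_right hab, Matrix.mul_add, Matrix.add_mul,
        Matrix.mul_smul, Matrix.smul_mul, Matrix.mul_smul, Matrix.smul_mul, ibqSmul_diag_conj,
        hab, hsq, hmap]

end Summit.ValiantsHypothesis.ValiantsHypothesis.Cruxes.WordLengthQP.EpsOrderLadder
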